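import Summits.AtomisticToContinuum.HydrodynamicLimit.Theses.PesinPricing

/-!
# Crux `PricingGlue` (stmt-AtomisticToContinuum-14643) — birth skeleton (BC3), line `birth`

Route `route-AtomisticToContinuum-PesinPricing`, sub-problem `HydrodynamicLimit`. The crux is the pure glue
`PricingGlue := UpperVolumeLemma → KiferYoungUpperR → PesinSaturationRigidityR → PricedBoltzmannProperty`
(route file `Theses/PesinPricing.lean`, decl by name below). This file cuts it along the foreseen glued split of its
docstring ("DefectRate · PalmPiecing · ComponentLemma → PricingGlue", steps (1)–(8) of the PROOF ROUTE paragraph of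
`PricedBoltzmannProperty`) into THREE registered stubs, each stated verbatim over route decls and Literature
declarations only (no local abbreviation inside a stub signature, so a prover can restate it in a Theorems file):

* `stub_defectRate` — step (4), THE UNPRINTED STEP: the Pesin-defect rate `i = infPesinDefect` of `KiferYoungUpperR`
  is a GOOD RATE FUNCTION RELATIVE TO ITS ZERO SET on the admissible class `𝓛(σ,e₀)`: for `0 < σ < σ₀`, `e₀ > 0` and
  every local-weakly closed set `𝒜` of rooted laws containing NO Palm law of a zero-defect member of the class, the
  KY infimum of `i` over `𝒜 ∩ 𝓛(σ,e₀)` (literally the infimum expression of `KiferYoungUpperR`) is POSITIVE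
  (lower semicontinuity of `i` + local-weak sequential compactness of its sublevel sets + closedness of the class =
  existence of the infinite dynamics on bounded-defect limit laws). Why it might fail: `λ⁺` may drop at grazing-heavy
  limits; bounded-defect limit laws may carry no infinite flow.
* `stub_zeroDefectLocalisation` — steps (1)–(3), (5)–(7): ENERGY CUT (Cramér under the Maxwellian velocities of
  `G_N`), TRANSFER AT TIME 0 (`TransferInequality`, a landed theorem), KY ON THE CUT EVENT at speed `(N+1)^{4/3} T₀`
  fed with the positivity of `stub_defectRate`, BARYCENTRE + FLOW PIECING, PALM INVERSION and the STATIC ENTROPY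
  BUDGET (`GibbsInvariance`, landed): `UpperVolumeLemma → KiferYoungUpperR → DefectRate → ` parts (i)–(iii) of
  `PricedBoltzmannProperty` for every OVY limit state (intensity `σ³`, energy density `≤ e₀`, entropy-regular w.r.t.
  a dilute translation-invariant Gibbs state, regular stationary state of an equilibrium translation-covariant
  infinite flow with `infPesinDefect = 0`). Why it might fail: the frozen (zero-velocity) members of the class have
  `i = 0`, so the localisation must combine KY with the static budget; Palm inversion needs `PalmUniqueness`.
* `stub_diluteComponentGibbs` — step (8), the COMPONENT LEMMA applied to `PesinSaturationRigidityR`: for some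
  `η₀ > 0`, every regular stationary zero-defect state of an equilibrium translation-covariant infinite flow has its
  DILUTE PART `{a.s. density < η₀}` (normalised, when non-null) a mixture of hard-sphere Gibbs laws with `z ≥ 0`
  (ergodic decomposition; stationarity, regularity, `i = 0` (affinity H4, `i ≥ 0` H0) and the a.s. density bound
  pass to the a.e. spatially ergodic component; density-0 components are the vacuum = the `z = 0` law; `R` on the
  others). Why it might fail: spatially ergodic components of a stationary state need not be stationary.

`PricingGlue_of` is the sorry-free composition (pure logic: `η₀` from the third stub, `σ₀, e₀` from the second,
parts (i)–(iv) reassembled under `IsOVYLimitState`). The hypotheses of `PricingGlue_of` are the name-keyed aliases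
`Registered.stub_*` (abbrevs DEFINED AS `type_of%` the stub theorems, so alias = statement by construction; the
skeleton audit admits a hypothesis whose head's last name component is a declared stub — device of the registered
Lines files of FinalStateConjecture/TameCensorship). Sorries: exactly three, one inside each `stub_*`; nothing else.
Disproof used: none on file (`ledger crux ls stmt-AtomisticToContinuum-14643`: no workfiles, no Negative lemmas,
negatives index empty on V/KY/R/PBP per the crux-attack evidence ATTACK.md / ATTACK-G2.md).
-/

namespace Summit.AtomisticToContinuum.HydrodynamicLimit.Cruxes.PricingGlue.Birth

/-- STUB 1 · DEFECT RATE (step (4), the unprinted step; size L; hardest-in-kind): on the admissible class of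
`KiferYoungUpperR`, a local-weakly closed set of rooted laws that contains no Palm law of a ZERO-defect member has a
POSITIVE infimum of the Pesin-defect rate — `i` is a good rate function relative to its zero set. Leans on:
`Literature.Dynamics.Billiards.infPesinDefect`, `Literature.Analysis.FluidPDE.palmLaw`,
`Literature.Analysis.FunctionSpaces.PointConfig.IsLocalWeakClosed` (all landed); no Literature fact asserts it. -/
theorem stub_defectRate :
    ∃ σ₀ : ℝ, 0 < σ₀ ∧ ∀ σ : ℝ, 0 < σ → σ < σ₀ → ∀ e₀ : ℝ, 0 < e₀ → ∀ 𝒜 : Set (MeasureTheory.Measure (Literature.Analysis.FunctionSpaces.PointConfig (Literature.MathematicalPhysics.KineticTheory.V3 × Literature.MathematicalPhysics.KineticTheory.V3))), Literature.Analysis.FunctionSpaces.PointConfig.IsLocalWeakClosed 𝒜 → (∀ (P : MeasureTheory.Measure (Literature.Analysis.FunctionSpaces.PointConfig (Literature.MathematicalPhysics.KineticTheory.V3 × Literature.MathematicalPhysics.KineticTheory.V3))) (Ψ : Literature.Analysis.FluidPDE.InfiniteHardSphereFlow (Fin 3) 1), (MeasureTheory.IsProbabilityMeasure P ∧ Literature.Analysis.FluidPDE.IsTranslationInvariant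 P ∧ Literature.Analysis.FluidPDE.intensity P = ENNReal.ofReal (σ ^ 3) ∧ (∀ᵐ ω ∂P, Literature.Analysis.FluidPDE.IsHardCore 1 ω) ∧ Ψ.IsAEDefined P ∧ Ψ.IsStationary P ∧ ∫⁻ ω, Literature.Analysis.FluidPDE.rootKineticEnergy ω ∂(Literature.Analysis.FluidPDE.palmLaw P) ≤ ENNReal.ofReal e₀ ∧ Literature.Analysis.FluidPDE.palmLaw P ∈ 𝒜) → Literature.Dynamics.Billiards.infPesinDefect Ψ P ≠ 0) → 0 < (⨅ (P : MeasureTheory.Measure (Literature.Analysis.FunctionSpaces.PointConfig (Literature.MathematicalPhysics.KineticTheory.V3 × Literature.MathematicalPhysics.KineticTheory.V3))) (Ψ : Literature.Analysis.FluidPDE.InfiniteHardSphereFlow (Fin 3) 1) (_ : MeasureTheory.IsProbabilityMeasure P ∧ Literature.Analysis.FluidPDE.IsTranslationInvariant P ∧ Literature.Analysis.FluidPDE.intensity P = ENNReal.ofReal (σ ^ 3) ∧ (∀ᵐ ω ∂P, Literature.Analysis.FluidPDE.IsHardCore 1 ω) ∧ Ψ.IsAEDefined P ∧ Ψ.IsStationary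 P ∧ ∫⁻ ω, Literature.Analysis.FluidPDE.rootKineticEnergy ω ∂(Literature.Analysis.FluidPDE.palmLaw P) ≤ ENNReal.ofReal e₀ ∧ Literature.Analysis.FluidPDE.palmLaw P ∈ 𝒜), Literature.Dynamics.Billiards.infPesinDefect Ψ P) := by
  sorry

/-- STUB 2 · ZERO-DEFECT LOCALISATION OF THE OVY LIMIT STATES (steps (1)–(3), (5)–(7); size L): the upper
volume lemma, the Kifer–Young upper bound and the defect-rate property give parts (i)–(iii) of
`PricedBoltzmannProperty` for every OVY limit state (energy cut, transfer at time 0 by the landed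
`TransferInequality`, KY on the cut event, barycentre + flow piecing, Palm inversion, static entropy budget by the
landed `GibbsInvariance`). Stated with the defect-rate property SPELLED OUT as its third antecedent. -/
theorem stub_zeroDefectLocalisation :
    Summit.AtomisticToContinuum.HydrodynamicLimit.Theses.PesinPricing.UpperVolumeLemma → Summit.AtomisticToContinuum.HydrodynamicLimit.Theses.PesinPricing.KiferYoungUpperR → (∃ σ₀ : ℝ, 0 < σ₀ ∧ ∀ σ : ℝ, 0 < σ → σ < σ₀ → ∀ e₀ : ℝ, 0 < e₀ → ∀ 𝒜 : Set (MeasureTheory.Measure (Literature.Analysis.FunctionSpaces.PointConfig (Literature.MathematicalPhysics.KineticTheory.V3 × Literature.MathematicalPhysics.KineticTheory.V3))), Literature.Analysis.FunctionSpaces.PointConfig.IsLocalWeakClosed 𝒜 → (∀ (P : MeasureTheory.Measure (Literature.Analysis.FunctionSpaces.PointConfig (Literature.MathematicalPhysics.KineticTheory.V3 × Literature.MathematicalPhysics.KineticTheory.V3))) (Ψ : Literature.Analysis.FluidPDE.InfiniteHardSphereFlow (Fin 3) 1), (MeasureTheory.IsProbabilityMeasure P ∧ Literature.Analysis.FluidPDE.IsTranslationInvariant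 P ∧ Literature.Analysis.FluidPDE.intensity P = ENNReal.ofReal (σ ^ 3) ∧ (∀ᵐ ω ∂P, Literature.Analysis.FluidPDE.IsHardCore 1 ω) ∧ Ψ.IsAEDefined P ∧ Ψ.IsStationary P ∧ ∫⁻ ω, Literature.Analysis.FluidPDE.rootKineticEnergy ω ∂(Literature.Analysis.FluidPDE.palmLaw P) ≤ ENNReal.ofReal e₀ ∧ Literature.Analysis.FluidPDE.palmLaw P ∈ 𝒜) → Literature.Dynamics.Billiards.infPesinDefect Ψ P ≠ 0) → 0 < (⨅ (P : MeasureTheory.Measure (Literature.Analysis.FunctionSpaces.PointConfig (Literature.MathematicalPhysics.KineticTheory.V3 × Literature.MathematicalPhysics.KineticTheory.V3))) (Ψ : Literature.Analysis.FluidPDE.InfiniteHardSphereFlow (Fin 3) 1) (_ : MeasureTheory.IsProbabilityMeasure P ∧ Literature.Analysis.FluidPDE.IsTranslationInvariant P ∧ Literature.Analysis.FluidPDE.intensity P = ENNReal.ofReal (σ ^ 3) ∧ (∀ᵐ ω ∂P, Literature.Analysis.FluidPDE.IsHardCore 1 ω) ∧ Ψ.IsAEDefined P ∧ Ψ.IsStationary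 P ∧ ∫⁻ ω, Literature.Analysis.FluidPDE.rootKineticEnergy ω ∂(Literature.Analysis.FluidPDE.palmLaw P) ≤ ENNReal.ofReal e₀ ∧ Literature.Analysis.FluidPDE.palmLaw P ∈ 𝒜), Literature.Dynamics.Billiards.infPesinDefect Ψ P)) → ∀ (a₀ θ₀ : Literature.MathematicalPhysics.KineticTheory.T3 → ℝ) (u₀ : Literature.MathematicalPhysics.KineticTheory.T3 → Literature.MathematicalPhysics.KineticTheory.V3), Continuous a₀ → Continuous θ₀ → Continuous u₀ → (∀ x, 0 < a₀ x) → (∀ x, 0 < θ₀ x) → ∃ σ₀ : ℝ, 0 < σ₀ ∧ ∀ σ : ℝ, 0 < σ → σ < σ₀ → ∃ e₀ : ℝ, ∀ T₀ : ℝ, 0 < T₀ → ∀ (Φ : (N : ℕ) → Literature.Analysis.FluidPDE.HardSphereFlow (Literature.Analysis.FluidPDE.Torus.geometry (Fin 3)) (Literature.MathematicalPhysics.KineticTheory.hsDiameter σ N) (N + 1)) (μ : MeasureTheory.Measure (Literature.Analysis.FunctionSpaces.PointConfig (Literature.MathematicalPhysics.KineticTheory.V3 × Literature.MathematicalPhysics.KineticTheory.V3))),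 Literature.MathematicalPhysics.KineticTheory.IsOVYLimitState σ a₀ θ₀ u₀ T₀ Φ μ → (Literature.Analysis.FluidPDE.intensity μ = ENNReal.ofReal (σ ^ 3) ∧ Literature.MathematicalPhysics.KineticTheory.kineticEnergyDensity μ ≤ ENNReal.ofReal e₀ ∧ (∃ (z β : ℝ) (g : MeasureTheory.Measure (Literature.Analysis.FunctionSpaces.PointConfig (Literature.MathematicalPhysics.KineticTheory.V3 × Literature.MathematicalPhysics.KineticTheory.V3))), 0 < z ∧ z ≤ 2 * σ ^ 3 ∧ 0 < β ∧ Literature.Analysis.FluidPDE.IsHardSphereGibbs 1 z β 0 g ∧ Literature.Analysis.FluidPDE.IsTranslationInvariant g ∧ Literature.MathematicalPhysics.KineticTheory.PointProcess.IsEntropyRegular g μ) ∧ (∃ Φinf : Literature.Analysis.FluidPDE.InfiniteHardSphereFlow (Fin 3) 1, Φinf.IsEquilibriumFlow ∧ Φinf.IsTranslationCovariant ∧ Literature.MathematicalPhysics.KineticTheory.RegularStationaryState Φinf μ ∧ Literature.Dynamics.Billiards.infPesinDefect Φinf μ = 0)) := by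
  sorry

/-- STUB 3 · DILUTE COMPONENT LEMMA (step (8); size M–L): Pesin-saturation rigidity on the a.e. spatially
ergodic component makes the dilute part of every regular stationary zero-defect state of an equilibrium
translation-covariant infinite flow a mixture of hard-sphere Gibbs laws with `z ≥ 0` (vacuum = `z = 0`); the
conclusion is verbatim part (iv) of `PricedBoltzmannProperty` with its `η₀`. -/
theorem stub_diluteComponentGibbs :
    Summit.AtomisticToContinuum.HydrodynamicLimit.Theses.PesinPricing.PesinSaturationRigidityR → ∃ η₀ : ENNReal, 0 < η₀ ∧ ∀ (Φinf : Literature.Analysis.FluidPDE.InfiniteHardSphereFlow (Fin 3) 1), Φinf.IsEquilibriumFlow → Φinf.IsTranslationCovariant → ∀ (μ : MeasureTheory.Measure (Literature.Analysis.FunctionSpaces.PointConfig (Literature.MathematicalPhysics.KineticTheory.V3 × Literature.MathematicalPhysics.KineticTheory.V3))), Literature.MathematicalPhysics.KineticTheory.RegularStationaryState Φinf μ → Literature.Dynamics.Billiards.infPesinDefect Φinf μ = 0 → (let D : Set (Literature.Analysis.FunctionSpaces.PointConfig (Literature.MathematicalPhysics.KineticTheory.V3 × Literature.MathematicalPhysics.KineticTheory.V3))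 := {ω | ∀ᶠ n : ℕ in Filter.atTop, ((Literature.Analysis.FunctionSpaces.PointConfig.count ω (Literature.MathematicalPhysics.KineticTheory.PointProcess.centredBox n ×ˢ (Set.univ : Set Literature.MathematicalPhysics.KineticTheory.V3))) : ENNReal) < η₀ * MeasureTheory.volume (Literature.MathematicalPhysics.KineticTheory.PointProcess.centredBox (d := Fin 3) n)}; μ D ≠ 0 → ∃ (π : MeasureTheory.Measure (ℝ × ℝ × Literature.MathematicalPhysics.KineticTheory.V3)) (κ : ℝ × ℝ × Literature.MathematicalPhysics.KineticTheory.V3 → MeasureTheory.Measure (Literature.Analysis.FunctionSpaces.PointConfig (Literature.MathematicalPhysics.KineticTheory.V3 × Literature.MathematicalPhysics.KineticTheory.V3))), MeasureTheory.IsProbabilityMeasure π ∧ Measurable κ ∧ (∀ᵐ θ ∂π, 0 ≤ θ.1 ∧ 0 < θ.2.1 ∧ Literature.Analysis.FluidPDE.IsHardSphereGibbs 1 θ.1 θ.2.1 θ.2.2 (κ θ)) ∧ (μ D)⁻¹ • μ.restrict D = π.bind κ) := by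
  sorry

/-! ## Name-keyed aliases of the stub statements (hypotheses of the composition) -/

namespace Registered

/-- Alias of the statement of `stub_defectRate` (by `type_of%`, so alias = statement). -/
abbrev stub_defectRate : Prop :=
  type_of% @_root_.Summit.AtomisticToContinuum.HydrodynamicLimit.Cruxes.PricingGlue.Birth.stub_defectRate
/-- Alias of the statement of `stub_zeroDefectLocalisation`. -/
abbrev stub_zeroDefectLocalisation : Prop :=
  type_of% @_root_.Summit.AtomisticToContinuum.HydrodynamicLimit.Cruxes.PricingGlue.Birth.stub_zeroDefectLocalisation
/-- Alias of the statement of `stub_diluteComponentGibbs`. -/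
abbrev stub_diluteComponentGibbs : Prop :=
  type_of% @_root_.Summit.AtomisticToContinuum.HydrodynamicLimit.Cruxes.PricingGlue.Birth.stub_diluteComponentGibbs

end Registered

/-! ## The composition: the three stubs conclude the crux BY NAME (real proof, no `sorry`) -/

/-- **`PricingGlue` from the line** — pure logic: given `V`, `KY`, `R` (the antecedents of the crux), take `η₀` from
the dilute component lemma applied to `R`, `σ₀` and `e₀` from the zero-defect localisation applied to `V`, `KY` and
the defect-rate property, and reassemble parts (i)–(iv) of `PricedBoltzmannProperty` for every OVY limit state. -/
theorem PricingGlue_of :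
    Registered.stub_defectRate → Registered.stub_zeroDefectLocalisation → Registered.stub_diluteComponentGibbs →
      Summit.AtomisticToContinuum.HydrodynamicLimit.Theses.PesinPricing.PricingGlue := by
  intro hDR hLoc hComp hV hKY hR
  obtain ⟨η₀, hη₀, hDil⟩ := hComp hR
  unfold Summit.AtomisticToContinuum.HydrodynamicLimit.Theses.PesinPricing.PricedBoltzmannProperty
  refine ⟨η₀, hη₀, ?_⟩
  intro a₀ θ₀ u₀ ha hθ hu hap hθp
  obtain ⟨σ₀, hσ₀, H⟩ := hLoc hV hKY hDR a₀ θ₀ u₀ ha hθ hu hap hθp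
  refine ⟨σ₀, hσ₀, fun σ hσ hσ' => ?_⟩
  obtain ⟨e₀, He⟩ := H σ hσ hσ'
  refine ⟨e₀, fun T₀ hT₀ Φ μ hμ => ?_⟩
  obtain ⟨hint, hen, hreg, Φinf, hEq, hTC, hRS, hdef⟩ := He T₀ hT₀ Φ μ hμ
  exact ⟨hint, hen, hreg, ⟨Φinf, hEq, hTC, hRS, hdef⟩, hDil Φinf hEq hTC μ hRS hdef⟩

end Summit.AtomisticToContinuum.HydrodynamicLimit.Cruxes.PricingGlue.Birth
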